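import Summits.CriticalPhenomena.PercolationContinuityZ3.Theses.PercNonProliferation
import Summits.CriticalPhenomena.PercolationContinuityZ3.Theorems.FreeBoxPowerSaving.Negative.FreeBoxPowerSavingProfile
import Summits.CriticalPhenomena.PercolationContinuityZ3.Theorems.FreeBoxSparse.Negative.DCTFloor
import Summits.CriticalPhenomena.PercolationContinuityZ3.Theorems.PercNonProliferationFreeBoxPowerSavingRunawayClosure
import Summits.CriticalPhenomena.PercolationContinuityZ3.Theorems.PercNonProliferationFreeBoxPowerSavingLayerGain
import Summits.CriticalPhenomena.PercolationContinuityZ3.Theorems.PercNonProliferationFreeBoxPowerSavingSprinkledClosure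
import Summits.CriticalPhenomena.PercolationContinuityZ3.Theorems.PercNonProliferationFreeBoxPowerSavingInterfaceCrossMass
import Summits.CriticalPhenomena.PercolationContinuityZ3.Theorems.PercNonProliferationFreeBoxPowerSavingResidualDictionary
import Summits.CriticalPhenomena.PercolationContinuityZ3.Theorems.PercNonProliferationFreeBoxPowerSavingStraddlingGain
import Literature.Probability.Percolation.PlanarDuality

/-!
# Line skeleton — crux stmt-CriticalPhenomena-4447 `PercNonProliferation.FreeBoxPowerSaving`,
# line `Sketch-r2-ideator5` (card `subcritical-runaway-closure`, round-2 ideator 5)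

Lead `prover-line-stmt-CriticalPhenomena-4447-c4-0` (continuation of c3, 2026-08-16).  The ideator's
`Cruxes/FreeBoxPowerSaving/Sketch_r2_ideator5.lean` (rc 0, 0 sorries) proves the CLOSURE LEMMA over local
definitions (`sps`, `thr`, `NoLastViolatingScale`) but has no `stub_*` / `FreeBoxPowerSaving_of`; this file OWNS
and reshapes it: the seven stubs are spelled out def-free (v2.1: six LANDED and wired in by name, ONE `sorry` left = the residual) in `Sig` (registered texts), the composition
`FreeBoxPowerSaving_of : Sig.stub_noLastViolatingScale → crux` is glue only.

The crux: `∃ a C, 0 < a ∧ ∀ n ≥ 1, FA₂(p_c, n) ≤ C n^{-a}`, `FA₂(p, n) = S_p(n)/|B(n)|²`,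
`S_p(n) = Σ_{x,y∈B(n)} P_p(x ↔ y in B(n))` (`FreeBoxPowerSavingNegative.pairSum`), `s_p(n) := S_p(n)/|B(n)|`
(per-site in-box susceptibility).

## The line (Hutchcroft's runaway closure, arXiv:2103.17013 Prop. 2.7 / Lemma 2.8, transplanted to the free box)
* CLOSURE (`stub_runawayClosure`, PROVED in the sketch, to land): if below `p_c` a scale `n ≥ n₀` with
  `s_p(n) ≥ C n^{3-a}` is never the LAST such scale, then `FA₂(p_c,n) ≤ C' n^{-a}` for all `n ≥ 1` (the crux
  with the SAME exponent `a`; stated with the crux body unfolded so that `FreeBoxPowerSaving_of` is the only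
  theorem here concluding the crux by name) — because
  `s_p(m) ≤ χ(p) < ∞` bounds the violating scales (`pairSum_le_card_mul_chi`), a bounded nonempty set of
  naturals closed under "there is a larger element" is absurd, and `p ↑ p_c` is a left-continuity transfer of
  a cylinder polynomial (`freePairAverage_criticalProbI_le_of_forall_lt`).
* GAIN LEMMAS (every `p`, `n`; provable now; the nearest-neighbour substitutes for the long-edge gluing term):
  `stub_layerGain`  `S_p(n) + 2p·W_∂(p,n) ≤ S_p(n+1)`, `W_∂ = Σ_{x∈B(n)} Σ_{y∈∂ⁱⁿB(n)} P_p(x ↔ y in B(n))`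
  (each foot `y` has a private outward neighbour `φ y ∈ B(n+1) ∖ B(n)`, joined through one fresh independent edge);
  `stub_straddlingGain`  `27 S_p(n) + 36 Σ_{i<3} X_p^{(i)}(n) ≤ S_p(3n+1)`, `X^{(i)}` = pairs `x_i ≤ -1 < 0 ≤ y_i`
  of ONE free box joined inside it (the 27-tiling of `B(3n+1)` by translates of `B(n)` — landed superadditivity
  p122009 — plus the 54 internal interfaces, each straddled by a translate of `B(n)` inside `B(3n+1)`, both
  orientations; symmetry-free three-direction form); its one-interface core is registered separately as
  `stub_interfaceCrossMass` (`X^{(i)}(n) ≤` cross mass between blocks `v` and `v + e_i`, `v_i ≤ 1`), so that each helper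
  file stays ≤ 400 lines.
* SPRINKLED CLOSURE (`stub_sprinkledClosure`, lead, LANDED p127893): the same conclusion from SPRINKLED
  upward propagation (`s_p(n) ≥ T_n ⟹ s_q(m) ≥ T_m` for some `m > n`, any `q ≥ p + δ n` below `p_c`) with a summable,
  polynomially small budget `ε` (`δ n + ε m ≤ ε n`, `ε n |B(n)||B(n).sym2| ≤ T_n`), via Russo + mean value (Lipschitz
  in `p`) — the card's "the format tolerates sprinkling", kernel-checked.
* RESIDUAL (`stub_sprinkledResidual`, lead-held, OPEN, crux-EQUIVALENT — see §5): the weakest form the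
  closures accept (sprinkled; the plain `NoLastViolatingScale` implies it, §4).  Its intended instance is `TopScaleGrowth` (propagation per tripling, merging efficiency
  `≥ e(a) = (3^{3-a} - 1)/26` above threshold at `p < p_c`); the gain lemmas certify at most
  `36 Σ_i X^{(i)} ≤ 54 S` worth of cross mass, i.e. efficiency `≤ 1/13 < e(a)` for every `a < 2`, so they cannot
  discharge it alone (§5 `two_mul_transEq_le_pairSum`).

Disproof v12 honoured: `false_at_one` (criticality enters once, through `p_c = sup{p : χ(p) < ∞}` inside the
closure; at `p = 1` there is no subcritical approach), `false_without_guard` (`1 ≤ n₀` is a hypothesis),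
`exponent_le_two` (the residual's `a` is free; `a < 3` is all the algebra needs), §7 `pairSum_le_card_mul_chi`
(imported, it IS the absurdity).
-/

noncomputable section

open MeasureTheory Filter
open Literature.Probability.Percolation Literature.Probability.LatticeModels
open Summit.CriticalPhenomena.PercolationContinuityZ3.Theses.PercNonProliferation
open Summit.CriticalPhenomena.PercolationContinuityZ3.FreeBoxPowerSavingNegative
  (pairSum fa2 freeBoxPowerSaving_iff_fa2 pairSum_nonneg card_box_pos card_box_real fa2_nonneg
    pairSum_le_card_mul_chi of_eventually)
open Summit.CriticalPhenomena.PercolationContinuityZ3.Theorems.FreeBoxSparse.Negative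
  (freePairAverage_criticalProbI_le_of_forall_lt freePairAverage_mono)
open scoped Topology BigOperators

namespace Summit.CriticalPhenomena.PercolationContinuityZ3.Cruxes.FreeBoxPowerSaving.RunawayClosureLine

/-! ## §1 Local vocabulary -/

/-- Per-site in-box susceptibility `s_p(n) = S_p(n)/|B(n)|`. -/
def sps (p : unitInterval) (n : ℕ) : ℝ := pairSum p n / ((box 3 n).card : ℝ)

/-- Threshold family `T_n = C n^{3-a}`. -/
def thr (C a : ℝ) (n : ℕ) : ℝ := C * (n : ℝ) ^ (3 - a)

/-- RESIDUAL, weakest form: below `p_c`, a violating scale `n ≥ n₀` (`s_p(n) ≥ C n^{3-a}`) is never the last. -/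
def NoLastViolatingScale (a C : ℝ) (n₀ : ℕ) : Prop :=
  ∀ p : unitInterval, (p : ℝ) < criticalProb (zdGraph 3) (0 : Site 3) → ∀ n : ℕ, n₀ ≤ n →
    thr C a n ≤ sps p n → ∃ m : ℕ, n < m ∧ thr C a m ≤ sps p m

/-- RESIDUAL, scale-map form: above-threshold mass at scale `n` forces it at scale `N n`, same `p < p_c`. -/
def UpwardPropagation (a C : ℝ) (n₀ : ℕ) (N : ℕ → ℕ) : Prop :=
  ∀ p : unitInterval, (p : ℝ) < criticalProb (zdGraph 3) (0 : Site 3) → ∀ n : ℕ, n₀ ≤ n →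
    thr C a n ≤ sps p n → thr C a (N n) ≤ sps p (N n)

/-- The residual's intended instance: propagation per tripling `n ↦ 3n+1`. -/
abbrev TopScaleGrowth (a C : ℝ) (n₀ : ℕ) : Prop := UpwardPropagation a C n₀ fun n => 3 * n + 1

/-- Boundary-rooted in-box mass `W_∂(p,n) = Σ_{x∈B(n)} Σ_{y∈∂ⁱⁿB(n)} P_p(x ↔ y in B(n))`. -/
def boundaryRootedSum (p : unitInterval) (n : ℕ) : ℝ :=
  ∑ x ∈ box 3 n, ∑ y ∈ innerBoundary (zdGraph 3) (box 3 n),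
    (bondPercolation (zdGraph 3) p).real (openConnIn (↑(box 3 n) : Set (Site 3)) x y)

/-- Trans-equatorial pair connectivity of the free box in direction `i`: pairs `x_i ≤ -1`, `0 ≤ y_i`. -/
def transEq (p : unitInterval) (n : ℕ) (i : Fin 3) : ℝ :=
  ∑ x ∈ (box 3 n).filter (fun x : Site 3 => x i ≤ -1), ∑ y ∈ (box 3 n).filter (fun y : Site 3 => 0 ≤ y i),
    (bondPercolation (zdGraph 3) p).real (openConnIn (↑(box 3 n) : Set (Site 3)) x y)

namespace Sig

/-- Registered text of `stub_runawayClosure` (the closure lemma, def-free: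
`NoLastViolatingScale a C n₀ → ∃ C', ∀ n ≥ 1, FA₂(p_c,n) ≤ C' n^{-a}`). -/
def stub_runawayClosure : Prop :=
  ∀ (a C : ℝ) (n₀ : ℕ), 0 < a → a < 3 → 0 < C → 1 ≤ n₀ →
    (∀ p : unitInterval, (p : ℝ) < criticalProb (zdGraph 3) (0 : Site 3) → ∀ n : ℕ, n₀ ≤ n →
      C * (n : ℝ) ^ (3 - a) ≤
        (∑ x ∈ box 3 n, ∑ y ∈ box 3 n,
          (bondPercolation (zdGraph 3) p).real (openConnIn (↑(box 3 n) : Set (Site 3)) x y)) /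
          ((box 3 n).card : ℝ) →
      ∃ m : ℕ, n < m ∧ C * (m : ℝ) ^ (3 - a) ≤
        (∑ x ∈ box 3 m, ∑ y ∈ box 3 m,
          (bondPercolation (zdGraph 3) p).real (openConnIn (↑(box 3 m) : Set (Site 3)) x y)) /
          ((box 3 m).card : ℝ)) →
    ∃ C' : ℝ, ∀ n : ℕ, 1 ≤ n →
      (∑ x ∈ box 3 n, ∑ y ∈ box 3 n,
        (bondPercolation (zdGraph 3) (criticalProbI 3)).real (openConnIn (↑(box 3 n) : Set (Site 3)) x y)) /
        ((box 3 n).card : ℝ) ^ 2 ≤ C' * (n : ℝ) ^ (-a)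

/-- Registered text of `stub_layerGain` (`S_p(n) + 2p W_∂(p,n) ≤ S_p(n+1)`, every `p`, `n`). -/
def stub_layerGain : Prop :=
  ∀ (p : unitInterval) (n : ℕ),
    (∑ x ∈ box 3 n, ∑ y ∈ box 3 n,
        (bondPercolation (zdGraph 3) p).real (openConnIn (↑(box 3 n) : Set (Site 3)) x y)) +
      2 * (p : ℝ) *
        (∑ x ∈ box 3 n, ∑ y ∈ innerBoundary (zdGraph 3) (box 3 n),
          (bondPercolation (zdGraph 3) p).real (openConnIn (↑(box 3 n) : Set (Site 3)) x y)) ≤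
    ∑ x ∈ box 3 (n + 1), ∑ y ∈ box 3 (n + 1),
      (bondPercolation (zdGraph 3) p).real (openConnIn (↑(box 3 (n + 1)) : Set (Site 3)) x y)

/-- Registered text of `stub_straddlingGain` (`27 S_p(n) + 36 Σ_i X_p^{(i)}(n) ≤ S_p(3n+1)`, every `p`, `n`). -/
def stub_straddlingGain : Prop :=
  ∀ (p : unitInterval) (n : ℕ),
    27 * (∑ x ∈ box 3 n, ∑ y ∈ box 3 n,
        (bondPercolation (zdGraph 3) p).real (openConnIn (↑(box 3 n) : Set (Site 3)) x y)) +
      36 * (∑ i : Fin 3, ∑ x ∈ (box 3 n).filter (fun x : Site 3 => x i ≤ -1),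
        ∑ y ∈ (box 3 n).filter (fun y : Site 3 => 0 ≤ y i),
          (bondPercolation (zdGraph 3) p).real (openConnIn (↑(box 3 n) : Set (Site 3)) x y)) ≤
    ∑ x ∈ box 3 (3 * n + 1), ∑ y ∈ box 3 (3 * n + 1),
      (bondPercolation (zdGraph 3) p).real (openConnIn (↑(box 3 (3 * n + 1)) : Set (Site 3)) x y)

/-- Registered text of `stub_interfaceCrossMass` (ONE-INTERFACE lemma feeding `stub_straddlingGain`: the cross mass
between the blocks `B(n) + c_v` and `B(n) + c_v + (2n+1)e_i` of `B(3n+1)`, `c_v = (2n+1)(v-1)`, dominates `X^{(i)}(n)`;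
every `p`, `n`, `i`, and every `v ∈ {0,1,2}³` with `v_i ≤ 1`). -/
def stub_interfaceCrossMass : Prop :=
  ∀ (p : unitInterval) (n : ℕ) (i : Fin 3) (v : Fin 3 → Fin 3), (v i : ℕ) ≤ 1 →
    (∑ x ∈ (box 3 n).filter (fun x : Site 3 => x i ≤ -1), ∑ y ∈ (box 3 n).filter (fun y : Site 3 => 0 ≤ y i),
        (bondPercolation (zdGraph 3) p).real (openConnIn (↑(box 3 n) : Set (Site 3)) x y)) ≤
    ∑ x ∈ box 3 n, ∑ y ∈ box 3 n,
      (bondPercolation (zdGraph 3) p).real (openConnIn (↑(box 3 (3 * n + 1)) : Set (Site 3))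
        (x + fun j => (2 * (n : ℤ) + 1) * (((v j : ℕ) : ℤ) - 1))
        (y + fun j => (2 * (n : ℤ) + 1) * (((v j : ℕ) : ℤ) - 1) + if j = i then (2 * (n : ℤ) + 1) else 0))

/-- Registered text of `stub_sprinkledClosure` (the SPRINKLED closure: sprinkled upward propagation with a
polynomially small budget still closes the crux; generalises `stub_runawayClosure`). -/
def stub_sprinkledClosure : Prop :=
  ∀ (a C : ℝ) (n₀ : ℕ) (δ ε : ℕ → ℝ), 0 < a → a < 3 → 0 < C → 1 ≤ n₀ →
    (∀ n : ℕ, 0 ≤ δ n) → (∀ n : ℕ, 0 ≤ ε n) → (∀ n m : ℕ, n < m → δ n + ε m ≤ ε n) →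
    (∀ n : ℕ, n₀ ≤ n → ε n < criticalProb (zdGraph 3) (0 : Site 3)) →
    (∀ n : ℕ, n₀ ≤ n →
      ε n * (((box 3 n).card : ℝ) * (((box 3 n).sym2).card : ℝ)) ≤ C * (n : ℝ) ^ (3 - a)) →
    (∀ (p q : unitInterval) (n : ℕ), n₀ ≤ n → (q : ℝ) < criticalProb (zdGraph 3) (0 : Site 3) →
      (p : ℝ) + δ n ≤ (q : ℝ) →
      C * (n : ℝ) ^ (3 - a) ≤
        (∑ x ∈ box 3 n, ∑ y ∈ box 3 n,
          (bondPercolation (zdGraph 3) p).real (openConnIn (↑(box 3 n) : Set (Site 3)) x y)) /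
          ((box 3 n).card : ℝ) →
      ∃ m : ℕ, n < m ∧ C * (m : ℝ) ^ (3 - a) ≤
        (∑ x ∈ box 3 m, ∑ y ∈ box 3 m,
          (bondPercolation (zdGraph 3) q).real (openConnIn (↑(box 3 m) : Set (Site 3)) x y)) /
          ((box 3 m).card : ℝ)) →
    ∃ C' : ℝ, ∀ n : ℕ, 1 ≤ n →
      (∑ x ∈ box 3 n, ∑ y ∈ box 3 n,
        (bondPercolation (zdGraph 3) (criticalProbI 3)).real (openConnIn (↑(box 3 n) : Set (Site 3)) x y)) /
        ((box 3 n).card : ℝ) ^ 2 ≤ C' * (n : ℝ) ^ (-a)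

/-- Registered text of `stub_sprinkledResidual` (the RESIDUAL in its weakest, sprinkled form; OPEN, lead-held,
crux-equivalent): some threshold `C n^{3-a}`, sprinkle `δ ≥ 0` and polynomially small budget `ε` such that, below
`p_c`, an above-threshold scale always has a larger above-threshold scale after sprinkling by `δ n`. -/
def stub_sprinkledResidual : Prop :=
  ∃ (a C : ℝ) (n₀ : ℕ) (δ ε : ℕ → ℝ), 0 < a ∧ a < 3 ∧ 0 < C ∧ 1 ≤ n₀ ∧
    (∀ n : ℕ, 0 ≤ δ n) ∧ (∀ n : ℕ, 0 ≤ ε n) ∧ (∀ n m : ℕ, n < m → δ n + ε m ≤ ε n) ∧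
    (∀ n : ℕ, n₀ ≤ n → ε n < criticalProb (zdGraph 3) (0 : Site 3)) ∧
    (∀ n : ℕ, n₀ ≤ n →
      ε n * (((box 3 n).card : ℝ) * (((box 3 n).sym2).card : ℝ)) ≤ C * (n : ℝ) ^ (3 - a)) ∧
    ∀ (p q : unitInterval) (n : ℕ), n₀ ≤ n → (q : ℝ) < criticalProb (zdGraph 3) (0 : Site 3) →
      (p : ℝ) + δ n ≤ (q : ℝ) →
      C * (n : ℝ) ^ (3 - a) ≤
        (∑ x ∈ box 3 n, ∑ y ∈ box 3 n,
          (bondPercolation (zdGraph 3) p).real (openConnIn (↑(box 3 n) : Set (Site 3)) x y)) /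
          ((box 3 n).card : ℝ) →
      ∃ m : ℕ, n < m ∧ C * (m : ℝ) ^ (3 - a) ≤
        (∑ x ∈ box 3 m, ∑ y ∈ box 3 m,
          (bondPercolation (zdGraph 3) q).real (openConnIn (↑(box 3 m) : Set (Site 3)) x y)) /
          ((box 3 m).card : ℝ)

/-- Registered text of `stub_sprinkledResidualIffCrux` (the RESIDUAL DICTIONARY: registered residual ↔ crux). -/
def stub_sprinkledResidualIffCrux : Prop :=
  (∃ (a C : ℝ) (n₀ : ℕ) (δ ε : ℕ → ℝ), 0 < a ∧ a < 3 ∧ 0 < C ∧ 1 ≤ n₀ ∧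
    (∀ n : ℕ, 0 ≤ δ n) ∧ (∀ n : ℕ, 0 ≤ ε n) ∧ (∀ n m : ℕ, n < m → δ n + ε m ≤ ε n) ∧
    (∀ n : ℕ, n₀ ≤ n → ε n < criticalProb (zdGraph 3) (0 : Site 3)) ∧
    (∀ n : ℕ, n₀ ≤ n →
      ε n * (((box 3 n).card : ℝ) * (((box 3 n).sym2).card : ℝ)) ≤ C * (n : ℝ) ^ (3 - a)) ∧
    ∀ (p q : unitInterval) (n : ℕ), n₀ ≤ n → (q : ℝ) < criticalProb (zdGraph 3) (0 : Site 3) →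
      (p : ℝ) + δ n ≤ (q : ℝ) →
      C * (n : ℝ) ^ (3 - a) ≤
        (∑ x ∈ box 3 n, ∑ y ∈ box 3 n,
          (bondPercolation (zdGraph 3) p).real (openConnIn (↑(box 3 n) : Set (Site 3)) x y)) /
          ((box 3 n).card : ℝ) →
      ∃ m : ℕ, n < m ∧ C * (m : ℝ) ^ (3 - a) ≤
        (∑ x ∈ box 3 m, ∑ y ∈ box 3 m,
          (bondPercolation (zdGraph 3) q).real (openConnIn (↑(box 3 m) : Set (Site 3)) x y)) /
          ((box 3 m).card : ℝ)) ↔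
    Summit.CriticalPhenomena.PercolationContinuityZ3.Theses.PercNonProliferation.FreeBoxPowerSaving

end Sig

/-! ## §2 Bridges to the local vocabulary (`Iff.rfl`) -/

/-- `Sig.stub_runawayClosure` in local words. [folklore] -/
theorem sig_runawayClosure_iff :
    Sig.stub_runawayClosure ↔ ∀ (a C : ℝ) (n₀ : ℕ), 0 < a → a < 3 → 0 < C → 1 ≤ n₀ →
      NoLastViolatingScale a C n₀ → ∃ C' : ℝ, ∀ n : ℕ, 1 ≤ n → fa2 (criticalProbI 3) n ≤ C' * (n : ℝ) ^ (-a) :=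
  Iff.rfl

/-- `Sig.stub_layerGain` in local words. [folklore] -/
theorem sig_layerGain_iff :
    Sig.stub_layerGain ↔ ∀ (p : unitInterval) (n : ℕ),
      pairSum p n + 2 * (p : ℝ) * boundaryRootedSum p n ≤ pairSum p (n + 1) :=
  Iff.rfl

/-- `Sig.stub_straddlingGain` in local words. [folklore] -/
theorem sig_straddlingGain_iff :
    Sig.stub_straddlingGain ↔ ∀ (p : unitInterval) (n : ℕ),
      27 * pairSum p n + 36 * ∑ i : Fin 3, transEq p n i ≤ pairSum p (3 * n + 1) :=
  Iff.rfl

/-- SPRINKLED upward propagation below `p_c` (sprinkle `δ n` when leaving scale `n`), the hypothesis shape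
shared by `Sig.stub_sprinkledClosure` and `Sig.stub_sprinkledResidual`. -/
def SprinkledPropagation (a C : ℝ) (n₀ : ℕ) (δ : ℕ → ℝ) : Prop :=
  ∀ (p q : unitInterval) (n : ℕ), n₀ ≤ n → (q : ℝ) < criticalProb (zdGraph 3) (0 : Site 3) →
    (p : ℝ) + δ n ≤ (q : ℝ) → thr C a n ≤ sps p n → ∃ m : ℕ, n < m ∧ thr C a m ≤ sps q m

/-- An admissible BUDGET for the sprinkle `δ`: `ε ≥ 0` pays at `n` for `δ n` and for every later scale,
stays below `p_c`, and is polynomially small against the threshold (`ε n |B(n)| |B(n).sym2| ≤ C n^{3-a}`). -/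
def AdmissibleBudget (a C : ℝ) (n₀ : ℕ) (δ ε : ℕ → ℝ) : Prop :=
  (∀ n : ℕ, 0 ≤ δ n) ∧ (∀ n : ℕ, 0 ≤ ε n) ∧ (∀ n m : ℕ, n < m → δ n + ε m ≤ ε n) ∧
    (∀ n : ℕ, n₀ ≤ n → ε n < criticalProb (zdGraph 3) (0 : Site 3)) ∧
    (∀ n : ℕ, n₀ ≤ n →
      ε n * (((box 3 n).card : ℝ) * (((box 3 n).sym2).card : ℝ)) ≤ C * (n : ℝ) ^ (3 - a))

/-- `Sig.stub_sprinkledResidual` in local words. [folklore] -/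
theorem sig_sprinkledResidual_iff :
    Sig.stub_sprinkledResidual ↔
      ∃ (a C : ℝ) (n₀ : ℕ) (δ ε : ℕ → ℝ), 0 < a ∧ a < 3 ∧ 0 < C ∧ 1 ≤ n₀ ∧
        (∀ n : ℕ, 0 ≤ δ n) ∧ (∀ n : ℕ, 0 ≤ ε n) ∧ (∀ n m : ℕ, n < m → δ n + ε m ≤ ε n) ∧
        (∀ n : ℕ, n₀ ≤ n → ε n < criticalProb (zdGraph 3) (0 : Site 3)) ∧
        (∀ n : ℕ, n₀ ≤ n →
          ε n * (((box 3 n).card : ℝ) * (((box 3 n).sym2).card : ℝ)) ≤ C * (n : ℝ) ^ (3 - a)) ∧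
        SprinkledPropagation a C n₀ δ :=
  Iff.rfl

/-! ## §3 Registered stubs -/

/-- **stub_runawayClosure (the CLOSURE LEMMA; LANDED p127511).**
If below `p_c` no violating scale `n ≥ n₀` is the last one, the crux holds with exponent `a`: for `p < p_c`
every violating `m` has `C m^{3-a} ≤ s_p(m) ≤ χ(p)` (`pairSum_le_card_mul_chi`), so violating scales are bounded
by `⌈(χ/C)^{1/(3-a)}⌉`; descent on `M + 1 - m` shows there is none `≥ n₀`; hence `FA₂(p,n) ≤ C n^{-a}` for
`p < p_c`, `n ≥ n₀` (`|B(n)| ≥ n³`); pass to `p_c` by `freePairAverage_criticalProbI_le_of_forall_lt` and absorb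
`n < n₀` by `of_eventually` (Hutchcroft, arXiv:2103.17013 Prop. 2.7). [cite: arXiv:2103.17013, Prop 2.7] -/
theorem stub_runawayClosure :
    ∀ (a C : ℝ) (n₀ : ℕ), 0 < a → a < 3 → 0 < C → 1 ≤ n₀ →
      (∀ p : unitInterval, (p : ℝ) < criticalProb (zdGraph 3) (0 : Site 3) → ∀ n : ℕ, n₀ ≤ n →
        C * (n : ℝ) ^ (3 - a) ≤
          (∑ x ∈ box 3 n, ∑ y ∈ box 3 n,
            (bondPercolation (zdGraph 3) p).real (openConnIn (↑(box 3 n) : Set (Site 3)) x y)) /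
            ((box 3 n).card : ℝ) →
        ∃ m : ℕ, n < m ∧ C * (m : ℝ) ^ (3 - a) ≤
          (∑ x ∈ box 3 m, ∑ y ∈ box 3 m,
            (bondPercolation (zdGraph 3) p).real (openConnIn (↑(box 3 m) : Set (Site 3)) x y)) /
            ((box 3 m).card : ℝ)) →
      ∃ C' : ℝ, ∀ n : ℕ, 1 ≤ n →
        (∑ x ∈ box 3 n, ∑ y ∈ box 3 n,
          (bondPercolation (zdGraph 3) (criticalProbI 3)).real
            (openConnIn (↑(box 3 n) : Set (Site 3)) x y)) /
          ((box 3 n).card : ℝ) ^ 2 ≤ C' * (n : ℝ) ^ (-a) :=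
  -- LANDED: p127511, Theorems/PercNonProliferationFreeBoxPowerSavingRunawayClosure.lean (worker, wave 1)
  Summit.CriticalPhenomena.PercolationContinuityZ3.FreeBoxPowerSavingLine.stub_runawayClosure

/-- **stub_layerGain (LAYER GAIN; every `p`, `n`; LANDED p127641).**  `S_p(n) + 2p·W_∂(p,n) ≤ S_p(n+1)`:
split the pairs of `B(n+1)`; pairs inside `B(n)` give `≥ S_p(n)` (monotonicity of `{x ↔ y in S}` in `S`); for
`x ∈ B(n)`, `y ∈ ∂ⁱⁿB(n)` let `φ y := y ± e_i` (`i` the first coordinate with `|y_i| = n`, sign of `y_i`, `+` if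
`y_i = 0 = n`) — an INJECTIVE map `∂ⁱⁿB(n) → B(n+1) ∖ B(n)` with `φ y ~ y`; then
`{x ↔ y in B(n)} ∩ {edge (y, φ y) open} ⊆ {x ↔ φ y in B(n+1)}` and the two events are independent (the first is
determined by the edges inside `B(n)`), so `P(x ↔ φ y in B(n+1)) ≥ p · P(x ↔ y in B(n))`; summing over the
injective image bounds the `B(n) × (B(n+1)∖B(n))` pairs below by `p W_∂`, and symmetrically (`openConnIn_comm`)
the reversed pairs. [folklore] -/
theorem stub_layerGain :
    ∀ (p : unitInterval) (n : ℕ),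
      (∑ x ∈ box 3 n, ∑ y ∈ box 3 n,
          (bondPercolation (zdGraph 3) p).real (openConnIn (↑(box 3 n) : Set (Site 3)) x y)) +
        2 * (p : ℝ) *
          (∑ x ∈ box 3 n, ∑ y ∈ innerBoundary (zdGraph 3) (box 3 n),
            (bondPercolation (zdGraph 3) p).real (openConnIn (↑(box 3 n) : Set (Site 3)) x y)) ≤
      ∑ x ∈ box 3 (n + 1), ∑ y ∈ box 3 (n + 1),
        (bondPercolation (zdGraph 3) p).real (openConnIn (↑(box 3 (n + 1)) : Set (Site 3)) x y) :=
  -- LANDED: p127641, Theorems/PercNonProliferationFreeBoxPowerSavingLayerGain.lean (worker, wave 1)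
  Summit.CriticalPhenomena.PercolationContinuityZ3.FreeBoxPowerSavingLine.stub_layerGain

/-- **stub_straddlingGain (STRADDLING GAIN; every `p`, `n`; LANDED p128345).**
`27 S_p(n) + 36 Σ_{i<3} X_p^{(i)}(n) ≤ S_p(3n+1)`: `S_p(3n+1)` is a sum of nonnegative terms over ordered pairs of
`B(3n+1)`; restrict it to the disjoint union of (a) the pairs inside one of the 27 translates
`B_v = B(n) + (2n+1)v`, `v ∈ {-1,0,1}³` (each block `≥ S_p(n)`: landed `SubBoxesSuperadditive.sum_translates_le`,
p122009, with `PairSumShift.real_openConnIn_add_box`, p121659) and (b) for each direction `i`, each of the 18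
adjacent block pairs `(v, v + e_i)` (`v_i ∈ {-1,0}`) and each orientation, the image under `z ↦ z + c`,
`c = (2n+1)v + (n+1)e_i`, of the trans-equatorial pairs (`x_i ≤ -1`, `0 ≤ y_i`) of `B(n)`: the translate
`B(n) + c` lies in `B(3n+1)`, so `P(x+c ↔ y+c in B(3n+1)) ≥ P(x+c ↔ y+c in B(n)+c) = P(x ↔ y in B(n))`, giving
`X^{(i)}` per (pair, orientation), `2·18 = 36` per direction. [folklore] -/
theorem stub_straddlingGain :
    ∀ (p : unitInterval) (n : ℕ),
      27 * (∑ x ∈ box 3 n, ∑ y ∈ box 3 n,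
          (bondPercolation (zdGraph 3) p).real (openConnIn (↑(box 3 n) : Set (Site 3)) x y)) +
        36 * (∑ i : Fin 3, ∑ x ∈ (box 3 n).filter (fun x : Site 3 => x i ≤ -1),
          ∑ y ∈ (box 3 n).filter (fun y : Site 3 => 0 ≤ y i),
            (bondPercolation (zdGraph 3) p).real (openConnIn (↑(box 3 n) : Set (Site 3)) x y)) ≤
      ∑ x ∈ box 3 (3 * n + 1), ∑ y ∈ box 3 (3 * n + 1),
        (bondPercolation (zdGraph 3) p).real (openConnIn (↑(box 3 (3 * n + 1)) : Set (Site 3)) x y) :=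
  -- LANDED: p128345, Theorems/PercNonProliferationFreeBoxPowerSavingStraddlingGain.lean (worker, wave 1)
  Summit.CriticalPhenomena.PercolationContinuityZ3.FreeBoxPowerSavingLine.stub_straddlingGain

/-- **stub_interfaceCrossMass (ONE-INTERFACE cross mass; every `p`, `n`, `i`, `v` with `v_i ≤ 1`; LANDED p127982).**
With `c_v = (2n+1)(v-1)` (the sub-box offsets of the landed `stub_subBoxesSuperadditive`, p122009) and the straddling
offset `c' = c_v + (n+1)e_i`: `X^{(i)}(n) = Σ_{x_i ≤ -1, 0 ≤ y_i} P(x ↔ y in B(n)) = Σ P(x+c' ↔ y+c' in B(n)+c')`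
(`PairSumShift.real_openConnIn_add_box`, p121659) `≤ Σ P(x+c' ↔ y+c' in B(3n+1))` (`openConnIn_mono`: `B(n)+c' ⊆ B(3n+1)`
because `v_i ≤ 1`), and re-indexing `x+c' = (x + (n+1)e_i) + c_v`, `y + c' = (y - n e_i) + c_v + (2n+1)e_i` with
`x + (n+1)e_i, y - n e_i ∈ B(n)` injectively embeds the straddling pairs into `B(n) × B(n)` (nonnegative terms dropped).
[folklore] -/
theorem stub_interfaceCrossMass :
    ∀ (p : unitInterval) (n : ℕ) (i : Fin 3) (v : Fin 3 → Fin 3), (v i : ℕ) ≤ 1 →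
      (∑ x ∈ (box 3 n).filter (fun x : Site 3 => x i ≤ -1), ∑ y ∈ (box 3 n).filter (fun y : Site 3 => 0 ≤ y i),
          (bondPercolation (zdGraph 3) p).real (openConnIn (↑(box 3 n) : Set (Site 3)) x y)) ≤
      ∑ x ∈ box 3 n, ∑ y ∈ box 3 n,
        (bondPercolation (zdGraph 3) p).real (openConnIn (↑(box 3 (3 * n + 1)) : Set (Site 3))
          (x + fun j => (2 * (n : ℤ) + 1) * (((v j : ℕ) : ℤ) - 1))
          (y + fun j => (2 * (n : ℤ) + 1) * (((v j : ℕ) : ℤ) - 1) + if j = i then (2 * (n : ℤ) + 1) else 0)) :=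
  -- LANDED: p127982, Theorems/PercNonProliferationFreeBoxPowerSavingInterfaceCrossMass.lean (worker, wave 1)
  Summit.CriticalPhenomena.PercolationContinuityZ3.FreeBoxPowerSavingLine.stub_interfaceCrossMass

/-- **stub_sprinkledClosure (SPRINKLED RUNAWAY CLOSURE; lead, cycle 1; LANDED p127893).**  Russo's formula + the mean value inequality give the
Lipschitz bound `s_q(n) − s_p(n) ≤ |B(n)||B(n).sym2|(q − p)`; iterating the sprinkled propagation against
`χ(p + ε n) < ∞` rules out violations at `(p, n)` whenever `p + ε n < p_c`; the Lipschitz bound at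
`p = p_c − ε n − τ` transfers to `s_{p_c}(n) < 3 C n^{3-a}`. [folklore] -/
theorem stub_sprinkledClosure :
    ∀ (a C : ℝ) (n₀ : ℕ) (δ ε : ℕ → ℝ), 0 < a → a < 3 → 0 < C → 1 ≤ n₀ →
      (∀ n : ℕ, 0 ≤ δ n) → (∀ n : ℕ, 0 ≤ ε n) → (∀ n m : ℕ, n < m → δ n + ε m ≤ ε n) →
      (∀ n : ℕ, n₀ ≤ n → ε n < criticalProb (zdGraph 3) (0 : Site 3)) →
      (∀ n : ℕ, n₀ ≤ n →
        ε n * (((box 3 n).card : ℝ) * (((box 3 n).sym2).card : ℝ)) ≤ C * (n : ℝ) ^ (3 - a)) →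
      (∀ (p q : unitInterval) (n : ℕ), n₀ ≤ n → (q : ℝ) < criticalProb (zdGraph 3) (0 : Site 3) →
        (p : ℝ) + δ n ≤ (q : ℝ) →
        C * (n : ℝ) ^ (3 - a) ≤
          (∑ x ∈ box 3 n, ∑ y ∈ box 3 n,
            (bondPercolation (zdGraph 3) p).real (openConnIn (↑(box 3 n) : Set (Site 3)) x y)) /
            ((box 3 n).card : ℝ) →
        ∃ m : ℕ, n < m ∧ C * (m : ℝ) ^ (3 - a) ≤
          (∑ x ∈ box 3 m, ∑ y ∈ box 3 m,
            (bondPercolation (zdGraph 3) q).real (openConnIn (↑(box 3 m) : Set (Site 3)) x y)) /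
            ((box 3 m).card : ℝ)) →
      ∃ C' : ℝ, ∀ n : ℕ, 1 ≤ n →
        (∑ x ∈ box 3 n, ∑ y ∈ box 3 n,
          (bondPercolation (zdGraph 3) (criticalProbI 3)).real
            (openConnIn (↑(box 3 n) : Set (Site 3)) x y)) /
          ((box 3 n).card : ℝ) ^ 2 ≤ C' * (n : ℝ) ^ (-a) :=
  -- LANDED: p127893, Theorems/PercNonProliferationFreeBoxPowerSavingSprinkledClosure.lean (lead, cycle 1)
  Summit.CriticalPhenomena.PercolationContinuityZ3.FreeBoxPowerSavingLine.stub_sprinkledClosure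

/-- **stub_sprinkledResidual (the RESIDUAL, sprinkled weakest form; OPEN, lead-held; crux-EQUIVALENT, §5).**
For some exponent `0 < a < 3`, constant `C > 0`, `n₀ ≥ 1`, sprinkle `δ ≥ 0` and admissible budget `ε`
(`δ n + ε m ≤ ε n` for `m > n`, `ε n < p_c`, `ε n |B(n)||B(n).sym2| ≤ C n^{3-a}`): for every `n ≥ n₀`,
`q < p_c` with `p + δ n ≤ q`, if `s_p(n) ≥ C n^{3-a}` then `s_q(m) ≥ C m^{3-a}` for some `m > n`.
The plain residual (`δ = ε = 0`, `NoLastViolatingScale`) and `TopScaleGrowth` imply it (§4); no mechanism in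
print for nearest-neighbour `ℤ³` — Hutchcroft's is the long-edge gluing term, quadratic in volume; the
SprinklingRenormalisation barrier's escape hatch is admissible here only in polynomially small coin. [folklore] -/
theorem stub_sprinkledResidual :
    ∃ (a C : ℝ) (n₀ : ℕ) (δ ε : ℕ → ℝ), 0 < a ∧ a < 3 ∧ 0 < C ∧ 1 ≤ n₀ ∧
      (∀ n : ℕ, 0 ≤ δ n) ∧ (∀ n : ℕ, 0 ≤ ε n) ∧ (∀ n m : ℕ, n < m → δ n + ε m ≤ ε n) ∧
      (∀ n : ℕ, n₀ ≤ n → ε n < criticalProb (zdGraph 3) (0 : Site 3)) ∧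
      (∀ n : ℕ, n₀ ≤ n →
        ε n * (((box 3 n).card : ℝ) * (((box 3 n).sym2).card : ℝ)) ≤ C * (n : ℝ) ^ (3 - a)) ∧
      ∀ (p q : unitInterval) (n : ℕ), n₀ ≤ n → (q : ℝ) < criticalProb (zdGraph 3) (0 : Site 3) →
        (p : ℝ) + δ n ≤ (q : ℝ) →
        C * (n : ℝ) ^ (3 - a) ≤
          (∑ x ∈ box 3 n, ∑ y ∈ box 3 n,
            (bondPercolation (zdGraph 3) p).real (openConnIn (↑(box 3 n) : Set (Site 3)) x y)) /
            ((box 3 n).card : ℝ) →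
        ∃ m : ℕ, n < m ∧ C * (m : ℝ) ^ (3 - a) ≤
          (∑ x ∈ box 3 m, ∑ y ∈ box 3 m,
            (bondPercolation (zdGraph 3) q).real (openConnIn (↑(box 3 m) : Set (Site 3)) x y)) /
            ((box 3 m).card : ℝ) := by
  sorry

/-! ### Consistency: each name-keyed statement IS its stub (definitionally) -/

theorem stub_runawayClosure_registered : Sig.stub_runawayClosure := stub_runawayClosure
theorem stub_layerGain_registered : Sig.stub_layerGain := stub_layerGain
theorem stub_straddlingGain_registered : Sig.stub_straddlingGain := stub_straddlingGain
theorem stub_interfaceCrossMass_registered : Sig.stub_interfaceCrossMass := stub_interfaceCrossMass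
theorem stub_sprinkledClosure_registered : Sig.stub_sprinkledClosure := stub_sprinkledClosure
theorem stub_sprinkledResidual_registered : Sig.stub_sprinkledResidual := stub_sprinkledResidual

/-! ## §4 Composition (glue only) -/

/-- Upward propagation along a strictly increasing scale map gives the residual. [folklore] -/
theorem noLastViolatingScale_of_upwardPropagation {a C : ℝ} {n₀ : ℕ} {N : ℕ → ℕ}
    (hN : ∀ n, n < N n) (h : UpwardPropagation a C n₀ N) : NoLastViolatingScale a C n₀ :=
  fun p hp n hn hv => ⟨N n, hN n, h p hp n hn hv⟩

/-- `TopScaleGrowth` gives the residual. [folklore] -/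
theorem noLastViolatingScale_of_topScaleGrowth {a C : ℝ} {n₀ : ℕ} (h : TopScaleGrowth a C n₀) :
    NoLastViolatingScale a C n₀ :=
  noLastViolatingScale_of_upwardPropagation (fun n => by omega) h

/-- Monotonicity in `p` of `s_p(n)` (tree: `freePairAverage_mono`). [folklore] -/
theorem sps_mono (n : ℕ) {p q : unitInterval} (hpq : p ≤ q) : sps p n ≤ sps q n := by
  have hc := card_box_pos n
  have h := freePairAverage_mono hpq n
  change fa2 p n ≤ fa2 q n at h
  unfold fa2 at h
  unfold sps
  rw [div_le_div_iff_of_pos_right (by positivity)] at h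
  exact div_le_div_of_nonneg_right h hc.le

/-- The zero budget is admissible (`p_c(ℤ³) > 0`). [folklore] -/
theorem admissibleBudget_zero {a C : ℝ} (hC : 0 < C) (n₀ : ℕ) :
    AdmissibleBudget a C n₀ (fun _ => 0) (fun _ => 0) := by
  refine ⟨fun _ => le_rfl, fun _ => le_rfl, fun _ _ _ => by simp, fun _ _ => criticalProb_zd_pos 3 (by norm_num),
    fun n _ => ?_⟩
  rw [zero_mul]
  exact mul_nonneg hC.le (Real.rpow_nonneg (Nat.cast_nonneg n) _)

/-- The plain residual is the zero-sprinkle case: `NoLastViolatingScale a C n₀ → SprinkledPropagation a C n₀ 0`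
(monotonicity of `s_p(m)` in `p`). [folklore] -/
theorem sprinkledPropagation_zero_of_noLast {a C : ℝ} {n₀ : ℕ} (h : NoLastViolatingScale a C n₀) :
    SprinkledPropagation a C n₀ fun _ => 0 := by
  intro p q n hn hq hpq hv
  have hpq' : p ≤ q := by
    apply Subtype.coe_le_coe.1
    simpa using hpq
  have hp : (p : ℝ) < criticalProb (zdGraph 3) (0 : Site 3) := lt_of_le_of_lt (Subtype.coe_le_coe.2 hpq') hq
  obtain ⟨m, hm, hvm⟩ := h p hp n hn hv
  exact ⟨m, hm, hvm.trans (sps_mono m hpq')⟩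

/-- The plain residual (for some admissible exponent/constant/start) gives the registered sprinkled residual.
[folklore] -/
theorem sprinkledResidual_of_noLast
    (h : ∃ (a C : ℝ) (n₀ : ℕ), 0 < a ∧ a < 3 ∧ 0 < C ∧ 1 ≤ n₀ ∧ NoLastViolatingScale a C n₀) :
    Sig.stub_sprinkledResidual := by
  obtain ⟨a, C, n₀, ha, ha3, hC, hn₀, h⟩ := h
  obtain ⟨h1, h2, h3, h4, h5⟩ := admissibleBudget_zero (a := a) hC n₀
  exact ⟨a, C, n₀, fun _ => 0, fun _ => 0, ha, ha3, hC, hn₀, h1, h2, h3, h4, h5,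
    sprinkledPropagation_zero_of_noLast h⟩

/-- `TopScaleGrowth` gives the registered sprinkled residual. [folklore] -/
theorem sprinkledResidual_of_topScaleGrowth {a C : ℝ} {n₀ : ℕ} (ha : 0 < a) (ha3 : a < 3) (hC : 0 < C)
    (hn₀ : 1 ≤ n₀) (h : TopScaleGrowth a C n₀) : Sig.stub_sprinkledResidual :=
  sprinkledResidual_of_noLast ⟨a, C, n₀, ha, ha3, hC, hn₀, noLastViolatingScale_of_topScaleGrowth h⟩

/-- **`FreeBoxPowerSaving_of`**: the (sprinkled) residual gives the crux BY NAME, through the sprinkled closure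
stub. [folklore] -/
theorem FreeBoxPowerSaving_of (h : Sig.stub_sprinkledResidual) :
    Summit.CriticalPhenomena.PercolationContinuityZ3.Theses.PercNonProliferation.FreeBoxPowerSaving := by
  obtain ⟨a, C, n₀, δ, ε, ha, ha3, hC, hn₀, hδ, hε, hbud, hεpc, hεbud, H⟩ := h
  obtain ⟨C', hC'⟩ := stub_sprinkledClosure a C n₀ δ ε ha ha3 hC hn₀ hδ hε hbud hεpc hεbud H
  exact ⟨a, C', ha, hC'⟩

/-! ## §5 Lead analysis of the residual (sorry-free) -/

/-- **stub_sprinkledResidualIffCrux (RESIDUAL DICTIONARY; lead, cycle 1; LANDED p128349): the registered residual is EQUIVALENT to the crux** (`⟸` vacuously via the plain residual and `freePairAverage_mono`,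
`⟹` by `stub_sprinkledClosure`). [folklore] -/
theorem stub_sprinkledResidualIffCrux :
    (
      ∃ (a C : ℝ) (n₀ : ℕ) (δ ε : ℕ → ℝ), 0 < a ∧ a < 3 ∧ 0 < C ∧ 1 ≤ n₀ ∧
        (∀ n : ℕ, 0 ≤ δ n) ∧ (∀ n : ℕ, 0 ≤ ε n) ∧ (∀ n m : ℕ, n < m → δ n + ε m ≤ ε n) ∧
        (∀ n : ℕ, n₀ ≤ n → ε n < criticalProb (zdGraph 3) (0 : Site 3)) ∧
        (∀ n : ℕ, n₀ ≤ n →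
          ε n * (((box 3 n).card : ℝ) * (((box 3 n).sym2).card : ℝ)) ≤ C * (n : ℝ) ^ (3 - a)) ∧
        ∀ (p q : unitInterval) (n : ℕ), n₀ ≤ n → (q : ℝ) < criticalProb (zdGraph 3) (0 : Site 3) →
          (p : ℝ) + δ n ≤ (q : ℝ) →
          C * (n : ℝ) ^ (3 - a) ≤
            (∑ x ∈ box 3 n, ∑ y ∈ box 3 n,
              (bondPercolation (zdGraph 3) p).real (openConnIn (↑(box 3 n) : Set (Site 3)) x y)) /
              ((box 3 n).card : ℝ) →
          ∃ m : ℕ, n < m ∧ C * (m : ℝ) ^ (3 - a) ≤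
            (∑ x ∈ box 3 m, ∑ y ∈ box 3 m,
              (bondPercolation (zdGraph 3) q).real (openConnIn (↑(box 3 m) : Set (Site 3)) x y)) /
              ((box 3 m).card : ℝ)) ↔
    Summit.CriticalPhenomena.PercolationContinuityZ3.Theses.PercNonProliferation.FreeBoxPowerSaving :=
  -- LANDED: p128349, Theorems/PercNonProliferationFreeBoxPowerSavingResidualDictionary.lean (lead, cycle 1)
  Summit.CriticalPhenomena.PercolationContinuityZ3.FreeBoxPowerSavingLine.stub_sprinkledResidualIffCrux

theorem stub_sprinkledResidualIffCrux_registered : Sig.stub_sprinkledResidualIffCrux := stub_sprinkledResidualIffCrux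


/-- `X^{(i)} ≤ S/2`… is not needed; what the bookkeeping uses is the trivial `X^{(i)} ≤ S` (sub-sums of
nonnegative terms), whence the straddling certificate is at most `27 S + 108 S`-sized: STRADDLING CEILING —
`36 Σ_i X^{(i)} ≤ 108 S`. [folklore] -/
theorem transEq_le_pairSum (p : unitInterval) (n : ℕ) (i : Fin 3) : transEq p n i ≤ pairSum p n := by
  unfold transEq pairSum
  calc ∑ x ∈ (box 3 n).filter (fun x : Site 3 => x i ≤ -1), ∑ y ∈ (box 3 n).filter (fun y : Site 3 => 0 ≤ y i),
          (bondPercolation (zdGraph 3) p).real (openConnIn (↑(box 3 n) : Set (Site 3)) x y)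
        ≤ ∑ x ∈ (box 3 n).filter (fun x : Site 3 => x i ≤ -1), ∑ y ∈ box 3 n,
          (bondPercolation (zdGraph 3) p).real (openConnIn (↑(box 3 n) : Set (Site 3)) x y) := by
        refine Finset.sum_le_sum fun x _ => ?_
        exact Finset.sum_le_sum_of_subset_of_nonneg (Finset.filter_subset _ _)
          (fun _ _ _ => measureReal_nonneg)
    _ ≤ _ := Finset.sum_le_sum_of_subset_of_nonneg (Finset.filter_subset _ _)
          (fun _ _ _ => Finset.sum_nonneg fun _ _ => measureReal_nonneg)

/-- The REVERSED trans-equatorial sum equals `X^{(i)}` (symmetry of `{x ↔ y in S}` in `x, y`). [folklore] -/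
theorem transEq_rev_eq (p : unitInterval) (n : ℕ) (i : Fin 3) :
    (∑ x ∈ (box 3 n).filter (fun x : Site 3 => 0 ≤ x i), ∑ y ∈ (box 3 n).filter (fun y : Site 3 => y i ≤ -1),
        (bondPercolation (zdGraph 3) p).real (openConnIn (↑(box 3 n) : Set (Site 3)) x y)) = transEq p n i := by
  unfold transEq
  rw [Finset.sum_comm]
  refine Finset.sum_congr rfl fun x _ => Finset.sum_congr rfl fun y _ => ?_
  rw [Literature.Probability.Percolation.openConnIn_comm]

/-- **STRADDLING CEILING**: `2 X^{(i)} ≤ S` (the trans-equatorial ordered pairs and their reverses are disjoint families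
of ordered pairs of `B(n)`), hence `36 Σ_i X^{(i)} ≤ 54 S`: the straddling certificate alone yields merging
efficiency `≤ 54/702 = 1/13 = e(2)`, short of `e(a) = (3^{3-a}-1)/26` for every `a < 2`. [folklore] -/
theorem two_mul_transEq_le_pairSum (p : unitInterval) (n : ℕ) (i : Fin 3) : 2 * transEq p n i ≤ pairSum p n := by
  have hsplit : pairSum p n =
      (∑ x ∈ (box 3 n).filter (fun x : Site 3 => x i ≤ -1), ∑ y ∈ box 3 n,
          (bondPercolation (zdGraph 3) p).real (openConnIn (↑(box 3 n) : Set (Site 3)) x y)) +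
        ∑ x ∈ (box 3 n).filter (fun x : Site 3 => ¬ x i ≤ -1), ∑ y ∈ box 3 n,
          (bondPercolation (zdGraph 3) p).real (openConnIn (↑(box 3 n) : Set (Site 3)) x y) := by
    unfold pairSum
    rw [Finset.sum_filter_add_sum_filter_not]
  have hfilt : (box 3 n).filter (fun x : Site 3 => ¬ x i ≤ -1) = (box 3 n).filter (fun x : Site 3 => 0 ≤ x i) := by
    refine Finset.filter_congr fun x _ => ?_
    omega
  have h1 : transEq p n i ≤ ∑ x ∈ (box 3 n).filter (fun x : Site 3 => x i ≤ -1), ∑ y ∈ box 3 n,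
      (bondPercolation (zdGraph 3) p).real (openConnIn (↑(box 3 n) : Set (Site 3)) x y) := by
    unfold transEq
    refine Finset.sum_le_sum fun x _ => ?_
    exact Finset.sum_le_sum_of_subset_of_nonneg (Finset.filter_subset _ _) (fun _ _ _ => measureReal_nonneg)
  have h2 : transEq p n i ≤ ∑ x ∈ (box 3 n).filter (fun x : Site 3 => ¬ x i ≤ -1), ∑ y ∈ box 3 n,
      (bondPercolation (zdGraph 3) p).real (openConnIn (↑(box 3 n) : Set (Site 3)) x y) := by
    rw [hfilt, ← transEq_rev_eq p n i]
    refine Finset.sum_le_sum fun x _ => ?_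
    exact Finset.sum_le_sum_of_subset_of_nonneg (Finset.filter_subset _ _) (fun _ _ _ => measureReal_nonneg)
  rw [hsplit]
  linarith

/-- `|B(n)| ≤ 27 n³` for `n ≥ 1`. [folklore] -/
theorem card_box_le (n : ℕ) (hn : 1 ≤ n) : ((box 3 n).card : ℝ) ≤ 27 * (n : ℝ) ^ (3 : ℕ) := by
  rw [card_box_real]
  have h1 : (1 : ℝ) ≤ n := by exact_mod_cast hn
  have h2 : (2 * (n : ℝ) + 1) ≤ 3 * n := by linarith
  have h0 : (0 : ℝ) ≤ 2 * (n : ℝ) + 1 := by linarith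
  calc (2 * (n : ℝ) + 1) ^ 3 ≤ (3 * (n : ℝ)) ^ 3 := pow_le_pow_left₀ h0 h2 3
    _ = 27 * (n : ℝ) ^ (3 : ℕ) := by ring

/-- **CONVERSE (crux ⟹ residual, vacuously).**  If the crux holds with exponent `a₀`, then for any `a < a₀` the
threshold `n^{3-a}` is eventually never reached below `p_c` (`s_p(n) ≤ s_{p_c}(n) ≤ 27 C₀ n^{3-a₀}` by monotonicity in
`p`), so `NoLastViolatingScale a 1 N` holds with `a = min(a₀/2,1)`: the plain residual — hence the registered sprinkled
one — is crux-NECESSARY, hence (with the closure stubs) crux-EQUIVALENT: it cannot be refuted without refuting the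
crux. [folklore] -/
theorem noLast_of_crux
    (h : Summit.CriticalPhenomena.PercolationContinuityZ3.Theses.PercNonProliferation.FreeBoxPowerSaving) :
    ∃ (a C : ℝ) (n₀ : ℕ), 0 < a ∧ a < 3 ∧ 0 < C ∧ 1 ≤ n₀ ∧ NoLastViolatingScale a C n₀ := by
  obtain ⟨a₀, C₀, ha₀, h⟩ := h
  set a : ℝ := min (a₀ / 2) 1 with ha_def
  have ha : 0 < a := lt_min (by linarith) one_pos
  have ha3 : a < 3 := (min_le_right _ _).trans_lt (by norm_num)
  have haa₀ : a < a₀ := (min_le_left _ _).trans_lt (by linarith)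
  set K : ℝ := 27 * max C₀ 1 with hK_def
  have hKpos : 0 < K := by positivity
  obtain ⟨N, hN⟩ : ∃ N : ℕ, ∀ n : ℕ, N ≤ n → K < (n : ℝ) ^ (a₀ - a) := by
    have ht : Tendsto (fun n : ℕ => (n : ℝ) ^ (a₀ - a)) atTop atTop :=
      (tendsto_rpow_atTop (by linarith)).comp tendsto_natCast_atTop_atTop
    exact eventually_atTop.1 (ht.eventually_gt_atTop K)
  refine ⟨a, 1, max N 1, ha, ha3, one_pos, le_max_right _ _, ?_⟩
  intro p hp n hn hviol
  exfalso
  have hn1 : 1 ≤ n := (le_max_right _ _).trans hn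
  have hNn : N ≤ n := (le_max_left _ _).trans hn
  have hnpos : (0 : ℝ) < n := by exact_mod_cast hn1
  have hp' : p ≤ criticalProbI 3 := by
    apply le_of_lt
    change (p : ℝ) < (criticalProbI 3 : ℝ) at hp
    exact_mod_cast hp
  have hmono := freePairAverage_mono hp' n
  have hcrux := h n hn1
  change fa2 p n ≤ fa2 (criticalProbI 3) n at hmono
  change fa2 (criticalProbI 3) n ≤ C₀ * (n : ℝ) ^ (-a₀) at hcrux
  change 1 * (n : ℝ) ^ (3 - a) ≤ pairSum p n / ((box 3 n).card : ℝ) at hviol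
  have hcardpos := card_box_pos n
  have hcard := card_box_le n hn1
  have hna₀ : 0 ≤ (n : ℝ) ^ (-a₀) := Real.rpow_nonneg hnpos.le _
  -- `s_p(n) = FA₂(p,n) · |B(n)| ≤ K n^{-a₀} n³`
  have hs : pairSum p n / ((box 3 n).card : ℝ) ≤ K * ((n : ℝ) ^ (-a₀) * (n : ℝ) ^ (3 : ℕ)) := by
    have hfa : pairSum p n / ((box 3 n).card : ℝ) = fa2 p n * ((box 3 n).card : ℝ) := by
      unfold fa2; field_simp
    rw [hfa]
    calc fa2 p n * ((box 3 n).card : ℝ)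
        ≤ (max C₀ 1 * (n : ℝ) ^ (-a₀)) * (27 * (n : ℝ) ^ (3 : ℕ)) := by
          apply mul_le_mul _ hcard hcardpos.le (mul_nonneg (le_max_of_le_right zero_le_one) hna₀)
          exact (hmono.trans hcrux).trans (mul_le_mul_of_nonneg_right (le_max_left _ _) hna₀)
      _ = K * ((n : ℝ) ^ (-a₀) * (n : ℝ) ^ (3 : ℕ)) := by rw [hK_def]; ring
  -- `K n^{-a₀} n³ < n^{a₀-a} n^{-a₀} n³ = n^{3-a}`
  have hpow3 : (0 : ℝ) < (n : ℝ) ^ (3 : ℕ) := pow_pos hnpos 3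
  have hna₀' : 0 < (n : ℝ) ^ (-a₀) := Real.rpow_pos_of_pos hnpos _
  have hlt : K * ((n : ℝ) ^ (-a₀) * (n : ℝ) ^ (3 : ℕ)) < (n : ℝ) ^ (3 - a) := by
    have h1 : K * ((n : ℝ) ^ (-a₀) * (n : ℝ) ^ (3 : ℕ)) <
        (n : ℝ) ^ (a₀ - a) * ((n : ℝ) ^ (-a₀) * (n : ℝ) ^ (3 : ℕ)) :=
      mul_lt_mul_of_pos_right (hN n hNn) (mul_pos hna₀' hpow3)
    have h2 : (n : ℝ) ^ (a₀ - a) * ((n : ℝ) ^ (-a₀) * (n : ℝ) ^ (3 : ℕ)) = (n : ℝ) ^ (3 - a) := by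
      rw [← mul_assoc, ← Real.rpow_add hnpos, ← Real.rpow_natCast, ← Real.rpow_add hnpos]
      norm_num
      ring_nf
    rw [h2] at h1
    exact h1
  have := hviol.trans hs
  linarith

/-- crux ⟹ the registered (sprinkled) residual. [folklore] -/
theorem residual_of_crux
    (h : Summit.CriticalPhenomena.PercolationContinuityZ3.Theses.PercNonProliferation.FreeBoxPowerSaving) :
    Sig.stub_sprinkledResidual :=
  sprinkledResidual_of_noLast (noLast_of_crux h)

/-- **The residual IS the crux** (given the closure stubs): `stub_sprinkledResidual ↔ FreeBoxPowerSaving`, and the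
plain `NoLastViolatingScale` sits in between.  So, like every residual filed on this crux so far (QG-NAS, poly-rare
shattering, (I₁) ∧ (B), EUC ⟸, CesaroBlocking ⟹), it is not refutable on its own; unlike them it is an implication
between two scales at a SUBCRITICAL parameter, with summable sprinkling admitted. [folklore] -/
theorem residual_iff_crux :
    Sig.stub_sprinkledResidual ↔
      Summit.CriticalPhenomena.PercolationContinuityZ3.Theses.PercNonProliferation.FreeBoxPowerSaving :=
  ⟨FreeBoxPowerSaving_of, residual_of_crux⟩

/-- The plain residual is crux-equivalent too. [folklore] -/
theorem noLast_iff_crux :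
    (∃ (a C : ℝ) (n₀ : ℕ), 0 < a ∧ a < 3 ∧ 0 < C ∧ 1 ≤ n₀ ∧ NoLastViolatingScale a C n₀) ↔
      Summit.CriticalPhenomena.PercolationContinuityZ3.Theses.PercNonProliferation.FreeBoxPowerSaving :=
  ⟨fun h => FreeBoxPowerSaving_of (sprinkledResidual_of_noLast h), noLast_of_crux⟩

/-- **The residual's exponent is capped by the DCT floor**: `NoLastViolatingScale a C n₀` (with `0 < a < 3`, `0 < C`,
`1 ≤ n₀`) forces `a ≤ 2`, because it gives the crux with exponent `a` (closure) and `FA₂(p_c,n) ≥ c n^{-2}`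
(`freeBoxPowerSaving_exponent_le_two`, Duminil-Copin–Tassion `φ_{p_c}(S) ≥ 1`).  So every instance `TopScaleGrowth a C n₀`
with `a > 2` is REFUTED (Disproof v12 §5 honoured), and the live window is `a ∈ (0, 1+η] ≈ (0, 0.954]`. [folklore] -/
theorem residual_exponent_le_two {a C : ℝ} {n₀ : ℕ} (ha : 0 < a) (ha3 : a < 3) (hC : 0 < C) (hn₀ : 1 ≤ n₀)
    (h : NoLastViolatingScale a C n₀) : a ≤ 2 := by
  obtain ⟨C', hC'⟩ := (sig_runawayClosure_iff.1 stub_runawayClosure_registered) a C n₀ ha ha3 hC hn₀ h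
  exact Summit.CriticalPhenomena.PercolationContinuityZ3.Theorems.FreeBoxSparse.Negative.freeBoxPowerSaving_exponent_le_two
    (a := a) (C := C') (fun n hn => hC' n hn)

/-- **TOP-SCALE NORMAL FORM (card, liberty L3).**  The residual fails iff there is a TOP-SCALE WORLD: a subcritical
`p` and a scale `n ≥ n₀` that violates the threshold while EVERY larger scale obeys it.  So a proof of the residual may
assume, for free, `s_p(m) < C m^{3-a}` for all `m > n` (negative information about all larger boxes) — the structure a
refutation-by-mechanism has to kill. [folklore] -/
theorem residual_iff_noTopScaleWorld (a C : ℝ) (n₀ : ℕ) :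
    NoLastViolatingScale a C n₀ ↔
      ¬ ∃ p : unitInterval, (p : ℝ) < criticalProb (zdGraph 3) (0 : Site 3) ∧ ∃ n : ℕ, n₀ ≤ n ∧
        thr C a n ≤ sps p n ∧ ∀ m : ℕ, n < m → sps p m < thr C a m := by
  constructor
  · rintro h ⟨p, hp, n, hn, hv, htop⟩
    obtain ⟨m, hm, hvm⟩ := h p hp n hn hv
    exact absurd hvm (not_le.2 (htop m hm))
  · intro h p hp n hn hv
    by_contra hcon
    push Not at hcon
    exact h ⟨p, hp, n, hn, hv, fun m hm => hcon m hm⟩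

end Summit.CriticalPhenomena.PercolationContinuityZ3.Cruxes.FreeBoxPowerSaving.RunawayClosureLine

end
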